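import Summits.QuantumFields.YangMills.Theorems.BalabanUVNodesN15KingModelContinuumSymbolRate
import Summits.QuantumFields.YangMills.Theorems.BalabanUVNodesN15KingModelBlockCovarianceContinuumNE2Unit
import Summits.QuantumFields.YangMills.Theorems.BalabanUVNodesN15KingModelContinuumKernelDecay
import Summits.QuantumFields.YangMills.Theorems.BalabanUVNodesN15KingModelBlockFieldMeasureTotalVariation

/-!
# BalabanUVNodes ∕ N15 — THE KING-MODEL RUNG (PART Ϡ, PACKAGE): KING's §4 AT `η = 0` IN ONE THEOREM — the continuum symbol (4.5) with Lemma 4.3's rate at `n = ∞`,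
# NE2's unit-layer kernel `(Δ^{(K)})⁻¹ → C^{(∞)}` with (4.38)'s rate at `n = ∞`, `Δ^{(K)} → Δ^{(∞)}`, `Δ^{(∞)}C^{(∞)} = 1`, Thm 3.3's decay of `C^{(∞)}`, all exponential
# moments and total variation of the block-field laws — every limit EXPLICIT, every unit torus, hypothesis-free beyond `L` odd `≥ 2`, `a, m² > 0`
# (Track A, DAG node N15 = NE2; FAN-OUT v1.1 §N15 s3 «KING-MODEL RUNG … NE2's analogue DECIDED in the model»)

HONEST FRAMING.  Count-neutral (cell `pub-ymgap`, seat `pub-ymgap-dag-n15-e` g32; `--supports stmt-QuantumFields-27366 --as helper` = K3⁸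
`SpineGivenEndpointR13SepCoPHV`).  TEMPLATE LITERATURE: C. King, *The U(1) Higgs model. I. The continuum limit*, Commun. Math. Phys. **102** (1986) 649–677
[King1986] — KING's OWN `A = 0` MODEL; this module only ASSEMBLES parts Ϡ-a … Ϡ-m of the rung (files `…ContinuumSymbolWeights∕Series∕…Symbol∕…SymbolRate`,
`…BlockCovarianceFourier∕…ContinuumLimit∕…ContinuumForm∕…ContinuumNE2Unit`, `…EffectiveLaplacianContinuumLimit`, `…ContinuumKernelDecay`,
`…BlockFieldMeasureContinuumLimit∕…TotalVariation`, `…FreeRGContinuumAction`) into by-name handles.  NOT Bałaban's objects; NOT a node discharge (N15 is booked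
through n15-a's knit, untouched here); nothing continuum-Yang–Mills ∕ ℝ⁴ ∕ OS ∕ mass-gap ∕ Clay.  0 `sorry`; standard axioms; 0 `def`.

WHAT THIS FILE PROVES (kernel).  ★★★ **`king_eta_zero_package`** — for `L` odd `≥ 2`, `a, m² > 0` and EVERY unit torus `Ω = Π_{μ ≤ d} ℤ∕M_μ`, the conjunction:
(1) KING's (4.5) AT `η = 0`: `Δ^{(K)}(p′(q)) → Δ^{(∞)}(p′(q)) = (a_∞⁻¹ + Σ_{j∈ℤ^{d+1}}|u⁰(p′+2πj)|²∕(|p′+2πj|²+m²))⁻¹` for every momentum `q`;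
(2) LEMMA 4.3 WITH `n = ∞`: `|Δ^{(K)}(p′(q)) − Δ^{(∞)}(p′(q))| ≤ ((8∕3)a²(a⁻¹+π²∕48+1∕3) + (4∕3)a)·L^{−2K}`, `K ≥ 1`;
(3) NE2's UNIT KERNEL: `(Δ^{(K)})⁻¹(b,b′) → C^{(∞)}(b,b′)` (`blockCovLim`, explicit);  (4) (4.38) WITH `n = ∞`: `|(Δ^{(K)})⁻¹(b,b′) − C^{(∞)}(b,b′)| ≤ 2C_diff e^{−(κ_M∕2)|b−b′|_T}(L^K)⁻¹`;
(5) `Δ^{(K)}(b,b′) → Δ^{(∞)}(b,b′)` (`effLaplacianLim`, explicit) and `Δ^{(∞)}·C^{(∞)} = 1`;  (6) THM 3.3 (3.6) for `C^{(∞)}`: `|C^{(∞)}(b,b′)| ≤ (2∕γ_m)e^{−κ_M|b−b′|_T}`;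
(7) ALL EXPONENTIAL MOMENTS: `∫e^{⟨J,ψ⟩}ρ_K(ψ)dψ → e^{½⟨J,C^{(∞)}J⟩}` for every source `J`;  (8) TOTAL VARIATION: `∫|ρ_K − ρ_∞| → 0`.
★★★ **`king_eta_zero_ne2_package`** — the typed NE2 unit layer ∕ `N15At` of the node INHABITED by the `n = ∞` pair `((Δ^{(K)})⁻¹, C^{(∞)})` on the King-model family
(`d + 1 = 4` for `N15At`), hypothesis-free.

HONEST SCOPE.  Assembly only; see the parts for the mathematics and their scopes.  N15 untouched; counts unmoved.
Locators: [King1986] (2.13)–(2.16) p.653, Thm 2.1 (2.22) p.654, Thm 3.3 (3.6) p.655, Thm 3.4 (3.9) p.656, (4.3)–(4.5) p.670, Lemma 4.3 (4.18) p.672, (4.33)–(4.34),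
Lemma 4.5 (4.38) p.674, (4.39)–(4.41) pp.674–675.
-/

noncomputable section

open scoped BigOperators
open Finset Matrix Filter Topology MeasureTheory

namespace Summit.QuantumFields.YangMills.BalabanUVNodes.N15KingModelRung

open Literature.MathematicalPhysics.QuantumFieldTheory.Balaban1983to89.B5Prop11Plancherel (Tor sOf)
open Literature.MathematicalPhysics.QuantumFieldTheory.Balaban1983to89.T4EtaRate (NE2PlusUnit)
open Literature.MathematicalPhysics.QuantumFieldTheory.Balaban1983to89.T4EtaRateUnitWitness (NE2ZeroUnit)
open Literature.MathematicalPhysics.QuantumFieldTheory.King1986 (aK DeltaEff)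
open Literature.MathematicalPhysics.QuantumFieldTheory.King1986.Torus
open Summit.QuantumFields.YangMills.BalabanUVNodes.N15KingModelRung.FreeField (gaussNorm)
open YMDAG.UVSplit (N15At)

variable {d : ℕ}

section Package

variable (L : ℕ) (M : Fin (d + 1) → ℕ) [hM : ∀ μ, NeZero (M μ)]

/-- ★★★ **KING's §4 AT `η = 0`, PACKAGED** (`L` odd `≥ 2`, `a, m² > 0`, every unit torus): (1) the continuum symbol (4.5), (2) Lemma 4.3's rate with `n = ∞`, (3) NE2's unit
kernel `(Δ^{(K)})⁻¹ → C^{(∞)}` explicit, (4) the (4.38)-shape rate with `n = ∞`, (5) `Δ^{(K)} → Δ^{(∞)}` explicit with `Δ^{(∞)}C^{(∞)} = 1`, (6) Thm 3.3 (3.6) decay of `C^{(∞)}`,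
(7) convergence of all exponential moments of the block-field laws, (8) their total-variation convergence — parts Ϡ-c, Ϡ-h, Ϡ-e, Ϡ-g, Ϡ-j, Ϡ-k, Ϡ-m BY NAME.
[cite: King1986, (4.5) p.670, Lemma 4.3 (4.18) p.672, (2.14) p.653, Lemma 4.5 (4.38) p.674, Thm 3.3 (3.6) p.655, Thm 2.1 (2.22) p.654, Thm 3.4 (3.9) p.656] -/
theorem king_eta_zero_package (hLodd : Odd L) (hL : 2 ≤ L) {a m2 : ℝ} (ha : 0 < a) (hm : 0 < m2) :
    haveI : NeZero L := ⟨by omega⟩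
    (∀ q : Tor M, Tendsto (fun K : ℕ => DeltaEff (aK a L K) (L ^ K) m2 (sOf M q)) atTop (𝓝 (effSymLim a L m2 (sOf M q))))
    ∧ (∀ q : Tor M, ∀ K : ℕ, 1 ≤ K →
        |DeltaEff (aK a L K) (L ^ K) m2 (sOf M q) - effSymLim a L m2 (sOf M q)|
          ≤ (8 / 3 * (a ^ 2 * (a⁻¹ + Real.pi ^ 2 / 48 + 1 / 3)) + 4 / 3 * a) * ((L : ℝ) ^ (2 * K))⁻¹)
    ∧ (∀ b b' : Tor M, Tendsto (fun K : ℕ => blockCov L (L ^ K) M a m2 K b b') atTop (𝓝 (blockCovLim L M a m2 b b')))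
    ∧ (∀ b b' : Tor M, ∀ K : ℕ, 1 ≤ K →
        |blockCov L (L ^ K) M a m2 K b b' - blockCovLim L M a m2 b b'|
          ≤ 2 * CdiffM (d + 1) a m2 L * Real.exp (-(kapM (d + 1) a m2 L / 2 * tdistT M b b')) * ((L : ℝ) ^ K)⁻¹)
    ∧ ((∀ b b' : Tor M, Tendsto (fun K : ℕ => effLaplacian (L ^ K) M (aK a L K) (((L ^ K : ℕ) : ℝ) ^ 2) m2 b b') atTop (𝓝 (effLaplacianLim L M a m2 b b')))
        ∧ (Matrix.of fun b b' => effLaplacianLim L M a m2 b b') * (Matrix.of fun b b' => blockCovLim L M a m2 b b') = 1)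
    ∧ (∀ b b' : Tor M, |blockCovLim L M a m2 b b'| ≤ 2 / gamM a m2 L * Real.exp (-(kapM (d + 1) a m2 L * tdistT M b b')))
    ∧ (∀ J : Tor M → ℝ, Tendsto (fun K : ℕ => ∫ ψ : Tor M → ℝ, Real.exp (J ⬝ᵥ ψ)
        * (Real.exp (-(1 / 2 : ℝ) * (ψ ⬝ᵥ (effLaplacian (L ^ K) M (aK a L K) (((L ^ K : ℕ) : ℝ) ^ 2) m2 *ᵥ ψ)))
          / gaussNorm (effLaplacian (L ^ K) M (aK a L K) (((L ^ K : ℕ) : ℝ) ^ 2) m2))) atTop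
        (𝓝 (Real.exp ((1 / 2 : ℝ) * (J ⬝ᵥ ((Matrix.of fun b b' => blockCovLim L M a m2 b b') *ᵥ J))))))
    ∧ Tendsto (fun K : ℕ => ∫ ψ : Tor M → ℝ,
        |Real.exp (-(1 / 2 : ℝ) * (ψ ⬝ᵥ (effLaplacian (L ^ K) M (aK a L K) (((L ^ K : ℕ) : ℝ) ^ 2) m2 *ᵥ ψ)))
            / gaussNorm (effLaplacian (L ^ K) M (aK a L K) (((L ^ K : ℕ) : ℝ) ^ 2) m2)
          - Real.exp (-(1 / 2 : ℝ) * (ψ ⬝ᵥ ((Matrix.of fun b b' => effLaplacianLim L M a m2 b b') *ᵥ ψ)))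
            / gaussNorm (Matrix.of fun b b' => effLaplacianLim L M a m2 b b')|) atTop (𝓝 0) := by
  haveI : NeZero L := ⟨by omega⟩
  refine ⟨fun q => tendsto_DeltaEff_pow L M hLodd hL ha hm q, fun q K hK => abs_DeltaEff_sub_lim_le L M hLodd hL ha hm hK q,
    fun b b' => tendsto_blockCov L M hLodd hL ha hm b b', fun b b' K hK => abs_blockCov_sub_lim_le L M hLodd hL ha hm hK b b',
    ⟨fun b b' => tendsto_effLaplacian L M hLodd hL ha hm b b', effLaplacianLim_mul_blockCovLim L M hLodd hL ha hm⟩,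
    fun b b' => abs_blockCovLim_le_decay L M hLodd hL ha hm b b', fun J => ?_, tendsto_integral_abs_gaussDensity_sub L M hLodd hL ha hm⟩
  have h := tendsto_mgf_blockField L M hLodd hL ha hm J
  rwa [mgf_lim_eq L M hLodd hL ha hm J] at h

end Package

section NE2

variable (L : ℕ) [NeZero L]

/-- ★★★ **THE NODE's TYPED UNIT LAYER AGAINST THE CONTINUUM PARTNER, PACKAGED** (`L` odd `≥ 2`, `a, m² > 0`): on the King-model family, `NE2PlusUnit c35` (every `c35`)
and `NE2ZeroUnit` hold for the `n = ∞` difference kernel `(Δ^{(K)})⁻¹ − C^{(∞)}` (`blockCovLimUnit`), and for `d + 1 = 4` the node statement `N15At` holds at the carriers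
`kingVolCarriersLim` (every `c35`, `p`, `0 < γ ≤ 1`) — part Ϡ-i BY NAME. [cite: Balaban1985BackgroundPropagators, Thm 3.15 (3.187) p.432 (template); King1986, Lemma 4.5 (4.38) p.674] -/
theorem king_eta_zero_ne2_package (hLodd : Odd L) (hL : 2 ≤ L) {a m2 : ℝ} (ha : 0 < a) (hm : 0 < m2) :
    (∀ c35 : ℝ, NE2PlusUnit c35 (kingVolInstance d L) (blockCovLimUnit L a m2) (fun _ _ => True) (kingUnitDist L))
    ∧ NE2ZeroUnit (kingVolInstance d L) (blockCovLimUnit L a m2) (fun _ _ => True) (kingUnitDist L)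
    ∧ (∀ (γ : ℝ), 0 < γ → γ ≤ 1 → ∀ c35 p : ℝ, N15At (kingVolCarriersLim L a m2 c35 p)) :=
  ⟨fun c35 => ne2PlusUnit_blockCovLim L hLodd hL ha hm c35, ne2ZeroUnit_blockCovLim L hLodd hL ha hm,
    fun _ hγ0 hγ1 c35 p => n15At_kingModelRung_lim L hLodd hL ha hm hγ0 hγ1 c35 p⟩

end NE2

end Summit.QuantumFields.YangMills.BalabanUVNodes.N15KingModelRung

end
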